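import Literature.NumberTheory.GaloisRepresentations.ContinuousShapiroOpenCoinducedRightAction
import Literature.RepresentationTheory.FiniteGroups.StableLatticeReductionInvariant
import Mathlib.RepresentationTheory.Basic
import Mathlib.LinearAlgebra.TensorProduct.Basic
import HarnessLib

/-!
# The dictionary `M ⊗_ℤ ℤ[X]/p ≅ Maps(X, M)` (diagonal action) and `Maps(Q ⧸ H̄, M) = Maps(G ⧸ U, M)`:
# permutation tensors are the coinduced modules `coindOpen` (Serre, *Corps locaux* VII §5;
# Milne ADT I Lemma 5.4 (b))

Topic `NumberTheory/GaloisRepresentations`; namespace `Literature.NumberTheory.GaloisRepresentations`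
(dot notation under `Representation` / `ContinuousRep`).  Definitions with bodies (two explicit
equivalences) and theorems; no named fact, no `sorry`, no instance, no notation.

For a group `Q`, a FINITE `Q`-set `X`, a prime (indeed any integer) `p` and a `ℤ[Q]`-module `M`
KILLED BY `p`, the `ℤ[Q]`-module `M ⊗_ℤ (ℤ[X] / p ℤ[X])` (diagonal action, Mathlib
`Representation.tprod` of `σ` with the reduction mod `p` of the permutation module
`Representation.ofMulAction ℤ Q X` on `MonoidAlgebra ℤ X` — the objects of the lane's algebra side
`StableLatticeReduction` / `PermutationLattice` / `ArtinTwist`) is the module of functions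
`Maps(X, M)` with the diagonal action `(g φ)(x) = g • φ(g⁻¹ x)`:

* §1 **`Representation.tprodPermQuotEquiv X p hM : M ⊗[ℤ] (ℤ[X] ⧸ p•⊤) ≃ₗ[ℤ] (X → M)`**,
  `m ⊗ [f] ↦ (x ↦ f(x) • m)`, inverse `φ ↦ Σ_x φ(x) ⊗ [δ_x]`, and its equivariance
  `tprodPermQuotEquiv_rep : e ((σ ⊗ ℤ[X]/p) g t) = fun x => σ g (e t (g⁻¹ • x))`
  (Milne I Lemma 5.4 (b); Serre VII §5: `A ⊗ ℤ[G/H]`);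
* §2 for a compact group `G`, an open normal `W ⊴ G` acting trivially on the discrete `G`-module
  `M`, `Q = G ⧸ W`, `H̄ ≤ Q` and `U = H̄.comap (G → Q)` (open, `W ≤ U`): the `G`-equivariant
  bijection `quotientComapEquiv : G ⧸ U ≃ Q ⧸ H̄` and
  **`ContinuousRep.coindOpenTensorEquiv : (G ⧸ U → M) ≃+ M ⊗[ℤ] (ℤ[Q ⧸ H̄] ⧸ p•⊤)`** intertwining
  `ρ.coindOpen U hU g` with `(σ ⊗ ℤ[Q/H̄]/p) (g W)` for the descended `σ : Representation ℤ Q M`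
  (`coindOpenTensorEquiv_rep`); hence for ANY discrete model `T ≅ M ⊗ ℤ[Q/H̄]/p` of the tensor
  representation: `Hⁿ(G, Maps(G ⧸ U, M)) ≃+ Hⁿ(G, T)`, `#Hⁿ(G, T) = #Hⁿ(U, M)`, `#T = #M ^ [G : U]`.

Lane «TATE-EPC-TC» (stmt-BirchSwinnertonDyer-19032): the dictionary between the algebra bricks B3
(on `M ⊗ ℤ[Q/H̄]/p`) and the cohomological bricks B2 (Shapiro for `Maps(G ⧸ U, M)`).  HONEST
FRAMING: module theory only; no arithmetic statement and no case of BSD is proved here.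

## References
* J.-P. Serre, *Corps locaux* / *Local Fields* (1979), VII §5. [SerreLocalFields1979]
* J. S. Milne, *Arithmetic Duality Theorems*, 2nd ed. (2006), I Lemma 5.4 (b), I §2. [MilneADT2006]
* J.-P. Serre, *Linear Representations of Finite Groups*, GTM 42 (1977), §3.3 (induced
  representations, permutation representations). [SerreLinearRepresentations1977]
-/

noncomputable section

open CategoryTheory Function TensorProduct
open scoped TensorProduct Pointwise

universe u

namespace Literature.NumberTheory.GaloisRepresentations
/-! ## §1 `M ⊗_ℤ ℤ[X]/p ≃ Maps(X, M)` for `pM = 0` -/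
namespace Representation

variable {Q : Type u} [Group Q] {M : Type u} [AddCommGroup M] (σ : _root_.Representation ℤ Q M)
  (X : Type u) [MulAction Q X] [Fintype X] (p : ℕ) (hM : ∀ m : M, (p : ℤ) • m = 0)

/-- The permutation module `ℤ[X]` reduced mod `p`, as a `ℤ[Q]`-module — the object
`(Representation.ofMulAction ℤ Q X).quotient ((p : ℤ) • ⊤) _` of the lane's algebra bricks.
[cite: SerreLinearRepresentations1977, §3.3] -/
abbrev permQuot : _root_.Representation ℤ Q (MonoidAlgebra ℤ X ⧸ ((p : ℤ) • ⊤ : Submodule ℤ (MonoidAlgebra ℤ X))) :=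
  (_root_.Representation.ofMulAction ℤ Q X).quotient ((p : ℤ) • ⊤)
    (Literature.RepresentationTheory.FiniteGroups.StableLatticeReduction.smul_top_le_comap _ _)

variable (M) in
/-- The bilinear evaluation `ℤ[X] → M → Maps(X, M)`, `f ↦ m ↦ (x ↦ f(x) • m)`.
[cite: MilneADT2006, I Lemma 5.4 (b)] -/
def evalSMul : MonoidAlgebra ℤ X →ₗ[ℤ] M →ₗ[ℤ] (X → M) :=
  LinearMap.mk₂ ℤ (fun f m => fun x => f.coeff x • m)
    (fun f f' m => funext fun x => by
      change (f + f').coeff x • m = f.coeff x • m + f'.coeff x • m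
      rw [MonoidAlgebra.coeff_add, Finsupp.add_apply, add_smul])
    (fun c f m => funext fun x => by
      change (c • f).coeff x • m = c • (f.coeff x • m)
      rw [MonoidAlgebra.coeff_smul, Finsupp.smul_apply, smul_eq_mul, mul_smul])
    (fun f m m' => funext fun x => by
      change f.coeff x • (m + m') = f.coeff x • m + f.coeff x • m'
      rw [smul_add])
    (fun c f m => funext fun x => by
      change f.coeff x • (c • m) = c • (f.coeff x • m)
      rw [smul_comm])

omit [Fintype X] in
/-- Formula for `evalSMul`. [cite: MilneADT2006, I Lemma 5.4 (b)] -/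
@[simp] theorem evalSMul_apply (f : MonoidAlgebra ℤ X) (m : M) (x : X) :
    evalSMul M X f m x = f.coeff x • m := rfl

omit [Fintype X] in
include hM in
/-- `p ℤ[X]` evaluates to zero on a module killed by `p`. [cite: MilneADT2006, I Lemma 5.4 (b)] -/
theorem smul_top_le_ker_evalSMul :
    ((p : ℤ) • ⊤ : Submodule ℤ (MonoidAlgebra ℤ X)) ≤ LinearMap.ker (evalSMul M X) := by
  intro f hf
  obtain ⟨f', -, rfl⟩ := (Submodule.mem_smul_pointwise_iff_exists f (p : ℤ) ⊤).1 hf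
  rw [LinearMap.mem_ker]
  ext m x
  rw [evalSMul_apply, MonoidAlgebra.coeff_smul, Finsupp.smul_apply, smul_eq_mul, mul_comm, mul_smul,
    hM, smul_zero, LinearMap.zero_apply, Pi.zero_apply]

/-- **`M ⊗_ℤ ℤ[X]/p → Maps(X, M)`, `m ⊗ [f] ↦ (x ↦ f(x) • m)`.** [cite: MilneADT2006, I Lemma 5.4 (b)] -/
def tprodPermQuotToFun :
    M ⊗[ℤ] (MonoidAlgebra ℤ X ⧸ ((p : ℤ) • ⊤ : Submodule ℤ (MonoidAlgebra ℤ X))) →ₗ[ℤ] (X → M) :=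
  TensorProduct.lift (Submodule.liftQ _ (evalSMul M X) (smul_top_le_ker_evalSMul X p hM)).flip

omit [Fintype X] in
/-- Formula on pure tensors. [cite: MilneADT2006, I Lemma 5.4 (b)] -/
@[simp] theorem tprodPermQuotToFun_tmul (m : M) (f : MonoidAlgebra ℤ X) (x : X) :
    tprodPermQuotToFun X p hM (m ⊗ₜ Submodule.Quotient.mk f) x = f.coeff x • m := rfl

variable (M) in
/-- **`Maps(X, M) → M ⊗_ℤ ℤ[X]/p`, `φ ↦ Σ_x φ(x) ⊗ [δ_x]`.** [cite: MilneADT2006, I Lemma 5.4 (b)] -/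
def tprodPermQuotInvFun :
    (X → M) →ₗ[ℤ] M ⊗[ℤ] (MonoidAlgebra ℤ X ⧸ ((p : ℤ) • ⊤ : Submodule ℤ (MonoidAlgebra ℤ X))) :=
  ∑ x : X, ((TensorProduct.mk ℤ M _).flip (Submodule.Quotient.mk (MonoidAlgebra.single x 1))).comp
    (LinearMap.proj x)

/-- Formula for `tprodPermQuotInvFun`. [cite: MilneADT2006, I Lemma 5.4 (b)] -/
theorem tprodPermQuotInvFun_apply (φ : X → M) :
    tprodPermQuotInvFun M X p φ = ∑ x : X, φ x ⊗ₜ Submodule.Quotient.mk (MonoidAlgebra.single x (1 : ℤ)) := by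
  rw [tprodPermQuotInvFun, LinearMap.sum_apply]
  rfl

/-- `ℤ[X] ∋ f = Σ_x f(x) δ_x` for `X` finite. [cite: SerreLinearRepresentations1977, §3.3] -/
theorem sum_coeff_smul_single (f : MonoidAlgebra ℤ X) :
    ∑ x : X, f.coeff x • MonoidAlgebra.single x (1 : ℤ) = f := by
  apply MonoidAlgebra.coeff_injective
  rw [MonoidAlgebra.coeff_sum]
  simp only [MonoidAlgebra.coeff_smul, MonoidAlgebra.coeff_single, Finsupp.smul_single_one]
  exact Finsupp.univ_sum_single f.coeff

/-- `inv ∘ to = id`. [cite: MilneADT2006, I Lemma 5.4 (b)] -/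
theorem tprodPermQuotInvFun_toFun
    (t : M ⊗[ℤ] (MonoidAlgebra ℤ X ⧸ ((p : ℤ) • ⊤ : Submodule ℤ (MonoidAlgebra ℤ X)))) :
    tprodPermQuotInvFun M X p (tprodPermQuotToFun X p hM t) = t := by
  induction t using TensorProduct.induction_on with
  | zero => rw [map_zero, map_zero]
  | add a b ha hb => rw [map_add, map_add, ha, hb]
  | tmul m q =>
    induction q using Submodule.Quotient.induction_on with
    | _ f =>
      rw [tprodPermQuotInvFun_apply]
      set P : Submodule ℤ (MonoidAlgebra ℤ X) := (p : ℤ) • ⊤ with hP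
      have h1 : ∀ x : X, tprodPermQuotToFun X p hM (m ⊗ₜ Submodule.Quotient.mk f) x ⊗ₜ[ℤ]
          (Submodule.Quotient.mk (MonoidAlgebra.single x (1 : ℤ)) : MonoidAlgebra ℤ X ⧸ P) =
          m ⊗ₜ P.mkQ (f.coeff x • MonoidAlgebra.single x 1) := fun x => by
        rw [tprodPermQuotToFun_tmul, map_zsmul]
        exact ((((TensorProduct.mk ℤ M (MonoidAlgebra ℤ X ⧸ P)).flip
          (Submodule.Quotient.mk (MonoidAlgebra.single x (1 : ℤ)))).map_smul (f.coeff x) m)).trans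
          ((TensorProduct.mk ℤ M (MonoidAlgebra ℤ X ⧸ P) m).map_smul (f.coeff x)
            (Submodule.Quotient.mk (MonoidAlgebra.single x (1 : ℤ)))).symm
      simp only [h1]
      rw [← TensorProduct.tmul_sum, ← map_sum, sum_coeff_smul_single]
      rfl

/-- `to ∘ inv = id`. [cite: MilneADT2006, I Lemma 5.4 (b)] -/
theorem tprodPermQuotToFun_invFun (φ : X → M) :
    tprodPermQuotToFun X p hM (tprodPermQuotInvFun M X p φ) = φ := by
  classical
  rw [tprodPermQuotInvFun_apply, map_sum]
  funext y
  rw [Finset.sum_apply]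
  simp only [tprodPermQuotToFun_tmul, MonoidAlgebra.coeff_single]
  rw [Finset.sum_eq_single y (fun x _ hx => by rw [Finsupp.single_apply, if_neg hx, zero_smul])
    (fun h => (h (Finset.mem_univ y)).elim), Finsupp.single_eq_same, one_smul]

/-- **`M ⊗_ℤ ℤ[X]/p ≃ₗ[ℤ] Maps(X, M)`** for `M` killed by `p` and `X` finite.
[cite: MilneADT2006, I Lemma 5.4 (b)] [cite: SerreLocalFields1979, VII §5] -/
def tprodPermQuotEquiv :
    M ⊗[ℤ] (MonoidAlgebra ℤ X ⧸ ((p : ℤ) • ⊤ : Submodule ℤ (MonoidAlgebra ℤ X))) ≃ₗ[ℤ] (X → M) :=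
  { tprodPermQuotToFun X p hM with
    invFun := tprodPermQuotInvFun M X p
    left_inv := tprodPermQuotInvFun_toFun X p hM
    right_inv := tprodPermQuotToFun_invFun X p hM }

/-- Formula on pure tensors. [cite: MilneADT2006, I Lemma 5.4 (b)] -/
@[simp] theorem tprodPermQuotEquiv_tmul (m : M) (f : MonoidAlgebra ℤ X) (x : X) :
    tprodPermQuotEquiv X p hM (m ⊗ₜ Submodule.Quotient.mk f) x = f.coeff x • m := rfl

/-- Formula for the inverse. [cite: MilneADT2006, I Lemma 5.4 (b)] -/
theorem tprodPermQuotEquiv_symm_apply (φ : X → M) :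
    (tprodPermQuotEquiv X p hM).symm φ =
      ∑ x : X, φ x ⊗ₜ Submodule.Quotient.mk (MonoidAlgebra.single x (1 : ℤ)) :=
  tprodPermQuotInvFun_apply X p φ

omit [Fintype X] in
/-- Coefficients of the permutation action: `(g f)(x) = f(g⁻¹ x)`. [cite: SerreLinearRepresentations1977, §3.3] -/
theorem coeff_ofMulAction_apply (g : Q) (f : MonoidAlgebra ℤ X) (x : X) :
    (_root_.Representation.ofMulAction ℤ Q X g f).coeff x = f.coeff (g⁻¹ • x) := by
  rw [_root_.Representation.ofMulAction_def]
  change (Finsupp.mapDomain (g • ·) f.coeff) x = f.coeff (g⁻¹ • x)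
  conv_lhs => rw [← smul_inv_smul g x]
  exact Finsupp.mapDomain_apply (MulAction.injective g) f.coeff (g⁻¹ • x)

/-- **Equivariance**: `tprodPermQuotEquiv` carries the diagonal action `σ ⊗ (ℤ[X]/p)` to the diagonal
action `(g φ)(x) = σ g (φ (g⁻¹ x))` on functions. [cite: MilneADT2006, I Lemma 5.4 (b)]
[cite: SerreLocalFields1979, VII §5] -/
theorem tprodPermQuotEquiv_rep (g : Q)
    (t : M ⊗[ℤ] (MonoidAlgebra ℤ X ⧸ ((p : ℤ) • ⊤ : Submodule ℤ (MonoidAlgebra ℤ X)))) :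
    tprodPermQuotEquiv X p hM ((σ.tprod (permQuot X p)) g t) =
      fun x => σ g (tprodPermQuotEquiv X p hM t (g⁻¹ • x)) := by
  induction t using TensorProduct.induction_on with
  | zero =>
    funext x
    simp only [map_zero, Pi.zero_apply]
  | add a b ha hb =>
    funext x
    simp only [map_add, Pi.add_apply, ha, hb]
  | tmul m q =>
    induction q using Submodule.Quotient.induction_on with
    | _ f =>
      funext x
      rw [_root_.Representation.tprod_apply, TensorProduct.map_tmul]
      change tprodPermQuotEquiv X p hM (σ g m ⊗ₜ Submodule.Quotient.mk
        (_root_.Representation.ofMulAction ℤ Q X g f)) x = _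
      rw [tprodPermQuotEquiv_tmul, tprodPermQuotEquiv_tmul, coeff_ofMulAction_apply, map_zsmul]

end Representation

/-! ## §2 `Maps(G ⧸ U, M) = M ⊗ ℤ[Ḡ ⧸ H̄]/p` for `U = H̄.comap (G → Ḡ)`, `Ḡ = G ⧸ W` -/

section QuotientComap

variable {G : Type u} [Group G] (W : Subgroup G) [W.Normal] (Hq : Subgroup (G ⧸ W))

/-- For `a b : G`: `a U = b U` iff `ā H̄ = b̄ H̄`, `U = H̄.comap (G → G ⧸ W)`. [cite: SerreLocalFields1979, VII §5] -/
theorem leftRel_comap_iff (a b : G) :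
    QuotientGroup.leftRel (Hq.comap (QuotientGroup.mk' W)) a b ↔
      QuotientGroup.leftRel Hq (a : G ⧸ W) (b : G ⧸ W) := by
  rw [QuotientGroup.leftRel_apply, QuotientGroup.leftRel_apply, Subgroup.mem_comap,
    QuotientGroup.mk'_apply, QuotientGroup.mk_mul, QuotientGroup.mk_inv]

/-- The map `G ⧸ U → Ḡ ⧸ H̄`, `g U ↦ ḡ H̄` (`U = H̄.comap (G → Ḡ)`, `Ḡ = G ⧸ W`).
[cite: SerreLocalFields1979, VII §5] -/
def quotientComapMap : G ⧸ Hq.comap (QuotientGroup.mk' W) → (G ⧸ W) ⧸ Hq :=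
  Quotient.map' (fun g : G => (g : G ⧸ W)) fun a b h => (leftRel_comap_iff W Hq a b).1 h

/-- Formula: `quotientComapMap (g U) = ḡ H̄`. [cite: SerreLocalFields1979, VII §5] -/
@[simp] theorem quotientComapMap_mk (g : G) :
    quotientComapMap W Hq (g : G ⧸ Hq.comap (QuotientGroup.mk' W)) = ((g : G ⧸ W) : (G ⧸ W) ⧸ Hq) := rfl

/-- `quotientComapMap` is a bijection. [cite: SerreLocalFields1979, VII §5] -/
theorem quotientComapMap_bijective : Function.Bijective (quotientComapMap W Hq) := by
  constructor
  · intro a b hab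
    induction a using QuotientGroup.induction_on with
    | H a =>
      induction b using QuotientGroup.induction_on with
      | H b =>
        rw [quotientComapMap_mk, quotientComapMap_mk] at hab
        exact Quotient.sound' ((leftRel_comap_iff W Hq a b).2 (Quotient.exact' hab))
  · intro y
    induction y using QuotientGroup.induction_on with
    | H c =>
      induction c using QuotientGroup.induction_on with
      | H g => exact ⟨(g : G ⧸ Hq.comap (QuotientGroup.mk' W)), rfl⟩

/-- **`G ⧸ U ≃ Ḡ ⧸ H̄`** for `U = H̄.comap (G → Ḡ)`, `Ḡ = G ⧸ W` (`H̄` any subgroup of `Ḡ`).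
[cite: SerreLocalFields1979, VII §5] -/
def quotientComapEquiv : G ⧸ Hq.comap (QuotientGroup.mk' W) ≃ (G ⧸ W) ⧸ Hq :=
  Equiv.ofBijective _ (quotientComapMap_bijective W Hq)

/-- Formula: `quotientComapEquiv (g U) = ḡ H̄`. [cite: SerreLocalFields1979, VII §5] -/
@[simp] theorem quotientComapEquiv_mk (g : G) :
    quotientComapEquiv W Hq (g : G ⧸ Hq.comap (QuotientGroup.mk' W)) = ((g : G ⧸ W) : (G ⧸ W) ⧸ Hq) := rfl

/-- `G`-equivariance: `e (g • y) = ḡ • e y`. [cite: SerreLocalFields1979, VII §5] -/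
theorem quotientComapEquiv_smul (g : G) (y : G ⧸ Hq.comap (QuotientGroup.mk' W)) :
    quotientComapEquiv W Hq (g • y) = (g : G ⧸ W) • quotientComapEquiv W Hq y := by
  induction y using QuotientGroup.induction_on with
  | H a => rw [MulAction.Quotient.smul_coe, smul_eq_mul, quotientComapEquiv_mk, quotientComapEquiv_mk,
      MulAction.Quotient.smul_coe, smul_eq_mul, QuotientGroup.mk_mul]

/-- `G`-equivariance of the inverse: `e⁻¹ (ḡ • x) = g • e⁻¹ x`. [cite: SerreLocalFields1979, VII §5] -/
theorem quotientComapEquiv_symm_smul (g : G) (x : (G ⧸ W) ⧸ Hq) :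
    (quotientComapEquiv W Hq).symm ((g : G ⧸ W) • x) = g • (quotientComapEquiv W Hq).symm x := by
  apply (quotientComapEquiv W Hq).injective
  rw [Equiv.apply_symm_apply, quotientComapEquiv_smul, Equiv.apply_symm_apply]

end QuotientComap

namespace ContinuousRep

variable {G : Type u} [Group G] [TopologicalSpace G] [IsTopologicalGroup G] [CompactSpace G]
variable {M : Type u} [AddCommGroup M] [TopologicalSpace M] [DiscreteTopology M]
variable (ρ : ContinuousRep G ℤ M) (W : Subgroup G) [W.Normal] (hWo : IsOpen (W : Set G))
  (σ : _root_.Representation ℤ (G ⧸ W) M) (hσ : ∀ (g : G) (m : M), ρ g m = σ (g : G ⧸ W) m)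
  (Hq : Subgroup (G ⧸ W)) (p : ℕ) (hM : ∀ m : M, (p : ℤ) • m = 0)

omit [CompactSpace G] in
include hWo in
/-- `U = H̄.comap (G → G ⧸ W)` is open (`G ⧸ W` is discrete for `W` open). [cite: SerreLocalFields1979, VII §5] -/
theorem isOpen_comap_mk : IsOpen ((Hq.comap (QuotientGroup.mk' W) : Subgroup G) : Set G) := by
  haveI : DiscreteTopology (G ⧸ W) := QuotientGroup.discreteTopology hWo
  exact (isOpen_discrete (Hq : Set (G ⧸ W))).preimage QuotientGroup.continuous_mk

include hWo in
/-- `Ḡ ⧸ H̄` is finite for `G` compact, `W` open. [cite: SerreLocalFields1979, VII §5] -/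
theorem finite_quotient_quotient : Finite ((G ⧸ W) ⧸ Hq) :=
  haveI : Finite (G ⧸ W) := Subgroup.quotient_finite_of_isOpen W hWo
  Quotient.finite _

/-- **`Maps(G ⧸ U, M) ≃+ M ⊗_ℤ ℤ[Ḡ ⧸ H̄]/p`** (`U = H̄.comap (G → Ḡ)`, `Ḡ = G ⧸ W`, `pM = 0`): reindex
along `G ⧸ U ≃ Ḡ ⧸ H̄` and apply `tprodPermQuotEquiv⁻¹`. [cite: SerreLocalFields1979, VII §5]
[cite: MilneADT2006, I Lemma 5.4 (b)] -/
def coindOpenTensorEquiv [Fintype ((G ⧸ W) ⧸ Hq)] :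
    (G ⧸ Hq.comap (QuotientGroup.mk' W) → M) ≃+
      M ⊗[ℤ] (MonoidAlgebra ℤ ((G ⧸ W) ⧸ Hq) ⧸ ((p : ℤ) • ⊤ : Submodule ℤ (MonoidAlgebra ℤ ((G ⧸ W) ⧸ Hq)))) :=
  ((LinearEquiv.funCongrLeft ℤ M (quotientComapEquiv W Hq)).symm.trans
    (Representation.tprodPermQuotEquiv ((G ⧸ W) ⧸ Hq) p hM).symm).toAddEquiv

omit [TopologicalSpace G] [IsTopologicalGroup G] [CompactSpace G] [TopologicalSpace M] [DiscreteTopology M] in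
/-- Formula: `tprodPermQuotEquiv (coindOpenTensorEquiv φ) x = φ (e⁻¹ x)`. [cite: MilneADT2006, I Lemma 5.4 (b)] -/
theorem tprodPermQuotEquiv_coindOpenTensorEquiv [Fintype ((G ⧸ W) ⧸ Hq)]
    (φ : G ⧸ Hq.comap (QuotientGroup.mk' W) → M) (x : (G ⧸ W) ⧸ Hq) :
    Representation.tprodPermQuotEquiv ((G ⧸ W) ⧸ Hq) p hM (coindOpenTensorEquiv W Hq p hM φ) x =
      φ ((quotientComapEquiv W Hq).symm x) := by
  change Representation.tprodPermQuotEquiv ((G ⧸ W) ⧸ Hq) p hM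
    ((Representation.tprodPermQuotEquiv ((G ⧸ W) ⧸ Hq) p hM).symm
      ((LinearEquiv.funCongrLeft ℤ M (quotientComapEquiv W Hq)).symm φ)) x = _
  rw [LinearEquiv.apply_symm_apply, LinearEquiv.funCongrLeft_symm, LinearEquiv.funCongrLeft_apply]
  rfl

include hσ in
/-- **Equivariance**: `coindOpenTensorEquiv` intertwines the coinduced action `ρ.coindOpen U hU g` with
the diagonal tensor action `(σ ⊗ ℤ[Ḡ/H̄]/p) ḡ` of the descended representation `σ` (`ρ g = σ ḡ`).
[cite: SerreLocalFields1979, VII §5] [cite: MilneADT2006, I Lemma 5.4 (b)] -/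
theorem coindOpenTensorEquiv_rep [Fintype ((G ⧸ W) ⧸ Hq)]
    (hU : IsOpen ((Hq.comap (QuotientGroup.mk' W) : Subgroup G) : Set G)) (g : G)
    (φ : G ⧸ Hq.comap (QuotientGroup.mk' W) → M) :
    coindOpenTensorEquiv W Hq p hM (ρ.coindOpen (Hq.comap (QuotientGroup.mk' W)) hU g φ) =
      (σ.tprod (Representation.permQuot ((G ⧸ W) ⧸ Hq) p)) (g : G ⧸ W) (coindOpenTensorEquiv W Hq p hM φ) := by
  apply (Representation.tprodPermQuotEquiv (M := M) ((G ⧸ W) ⧸ Hq) p hM).injective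
  rw [Representation.tprodPermQuotEquiv_rep]
  funext x
  rw [tprodPermQuotEquiv_coindOpenTensorEquiv, tprodPermQuotEquiv_coindOpenTensorEquiv,
    coindOpen_apply_apply, hσ, ← QuotientGroup.mk_inv, quotientComapEquiv_symm_smul]

include hσ hM in
/-- **`Hⁿ(G, Maps(G ⧸ U, M)) ≃+ Hⁿ(G, T)` for ANY discrete model `T ≅ M ⊗ ℤ[Ḡ/H̄]/p` of the tensor
representation** (`θ : T ≃+ M ⊗ …` intertwining `τ g` with `(σ ⊗ ℤ[Ḡ/H̄]/p) ḡ`): continuous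
cohomology of equivariantly isomorphic discrete coefficients. [cite: SerreLocalFields1979, VII §5]
[cite: MilneADT2006, I Lemma 5.4 (b)] -/
theorem nonempty_continuousCohomology_coindOpen_tensor_addEquiv [Fintype ((G ⧸ W) ⧸ Hq)]
    (hU : IsOpen ((Hq.comap (QuotientGroup.mk' W) : Subgroup G) : Set G))
    {T : Type u} [AddCommGroup T] [TopologicalSpace T] [DiscreteTopology T] (τ : ContinuousRep G ℤ T)
    (θ : T ≃+ M ⊗[ℤ] (MonoidAlgebra ℤ ((G ⧸ W) ⧸ Hq) ⧸
      ((p : ℤ) • ⊤ : Submodule ℤ (MonoidAlgebra ℤ ((G ⧸ W) ⧸ Hq)))))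
    (hτ : ∀ (g : G) (t : T), θ (τ g t) = (σ.tprod (Representation.permQuot ((G ⧸ W) ⧸ Hq) p)) (g : G ⧸ W) (θ t))
    (n : ℕ) :
    Nonempty ((continuousCohomology n (ρ.coindOpen (Hq.comap (QuotientGroup.mk' W)) hU).toTopRep : Type u) ≃+
      (continuousCohomology n τ.toTopRep : Type u)) := by
  haveI : DiscreteTopology (G ⧸ Hq.comap (QuotientGroup.mk' W) → M) := discreteTopology_coindOpen _ hU
  let η : (G ⧸ Hq.comap (QuotientGroup.mk' W) → M) ≃ₜ+ T :=
    { (coindOpenTensorEquiv W Hq p hM).trans θ.symm with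
      continuous_toFun := continuous_of_discreteTopology
      continuous_invFun := continuous_of_discreteTopology }
  refine ⟨continuousCohomologyAddEquiv (X := (ρ.coindOpen (Hq.comap (QuotientGroup.mk' W)) hU).toTopRep)
    (Y := τ.toTopRep) η (fun g φ => ?_) n⟩
  change θ.symm (coindOpenTensorEquiv W Hq p hM (ρ.coindOpen (Hq.comap (QuotientGroup.mk' W)) hU g φ)) =
    τ g (θ.symm (coindOpenTensorEquiv W Hq p hM φ))
  apply θ.injective
  rw [hτ, AddEquiv.apply_symm_apply, AddEquiv.apply_symm_apply]
  exact ρ.coindOpenTensorEquiv_rep W σ hσ Hq p hM hU g φ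

include hσ hWo hM in
/-- **`#Hⁿ(G, T) = #Hⁿ(U, M)`** for any discrete model `T` of `M ⊗ ℤ[Ḡ/H̄]/p`, `U = H̄.comap (G → Ḡ)`,
`G` profinite (Shapiro `ContinuousRep.natCard_continuousCohomology_coindOpen`).
[cite: SerreLocalFields1979, VII §5–§6] [cite: MilneADT2006, I §5 (proof of Thm. 5.1)] -/
theorem natCard_continuousCohomology_tensor_eq [T2Space G] [TotallyDisconnectedSpace G]
    [Fintype ((G ⧸ W) ⧸ Hq)]
    {T : Type u} [AddCommGroup T] [TopologicalSpace T] [DiscreteTopology T] (τ : ContinuousRep G ℤ T)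
    (θ : T ≃+ M ⊗[ℤ] (MonoidAlgebra ℤ ((G ⧸ W) ⧸ Hq) ⧸
      ((p : ℤ) • ⊤ : Submodule ℤ (MonoidAlgebra ℤ ((G ⧸ W) ⧸ Hq)))))
    (hτ : ∀ (g : G) (t : T), θ (τ g t) = (σ.tprod (Representation.permQuot ((G ⧸ W) ⧸ Hq) p)) (g : G ⧸ W) (θ t))
    (n : ℕ) :
    Nat.card (continuousCohomology n τ.toTopRep) =
      Nat.card (continuousCohomology n
        (ρ.restrict (subgroupIncl (Hq.comap (QuotientGroup.mk' W)))).toTopRep) := by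
  have hU := isOpen_comap_mk W hWo Hq
  obtain ⟨e⟩ := ρ.nonempty_continuousCohomology_coindOpen_tensor_addEquiv W σ hσ Hq p hM hU τ θ hτ n
  rw [← Nat.card_congr e.toEquiv]
  exact ρ.natCard_continuousCohomology_coindOpen (Hq.comap (QuotientGroup.mk' W)) hU n

omit [TopologicalSpace M] [DiscreteTopology M] in
include hWo hM in
/-- **`#(M ⊗ ℤ[Ḡ/H̄]/p) = #M ^ [G : U]`**, `U = H̄.comap (G → Ḡ)`. [cite: SerreLocalFields1979, VII §5] -/
theorem natCard_tensor_permQuot_eq [Fintype ((G ⧸ W) ⧸ Hq)] :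
    Nat.card (M ⊗[ℤ] (MonoidAlgebra ℤ ((G ⧸ W) ⧸ Hq) ⧸
        ((p : ℤ) • ⊤ : Submodule ℤ (MonoidAlgebra ℤ ((G ⧸ W) ⧸ Hq))))) =
      Nat.card M ^ (Hq.comap (QuotientGroup.mk' W)).index := by
  rw [← Nat.card_congr (coindOpenTensorEquiv (M := M) W Hq p hM).toEquiv]
  exact natCard_coindOpen (Hq.comap (QuotientGroup.mk' W)) (isOpen_comap_mk W hWo Hq)

end ContinuousRep

end Literature.NumberTheory.GaloisRepresentations

end
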